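import Summits.ResolutionOfSingularities.ResolutionOfSingularities.Theorems.WeightedInvariantLocalWeightedDropNCDirectrixCutWildFourOfLeaves

/-!
# `WeightedInvariant.LocalWeightedDrop` (stmt-ResolutionOfSingularities-8899), registered stubs W|₅₊ `stub_wildWideApexFiveUpStartsWon` and
# T|₅₊ `stub_tameWideApexFiveUpStartsWon`: THE KERNEL CENSUS IN EVERY DIMENSION — both VERBATIM from the four piece-families
# CRV · PL · FT · W in dimensions ≥ 4 (and PL₃ · FT₃ · W₃), the door, OX (every dimension) and CRV₃ discharged by name

[OURS · route `ResolutionOfSingularities/WeightedInvariant` · ENGINE crux `LocalWeightedDrop` (stmt-ResolutionOfSingularities-8899), skeleton v36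
`ae852bbacee88029` (registered stubs W′|₄, W|₅₊, T|₅₊).  The tree's `…NCDirectrixCut` §7 records the ladder in every dimension
(`TameFourTupleDrop.rd_all_of_histApexCut`: RD_m for all `m ≥ 2` from the door RD₂ and, for every `m ≥ 2`, the five history-first pieces
OX · CRV · PL · FT · W in dimension `m + 1`) and gives the by-name terms for W|₅₊ / T|₅₊ in a COMMENT («bookkeeping only — above dimension 4 the
families are open in print»).  Candidates of the programme's own count game; nothing here is a statement of, or about, any manuscript; AI-written,
weaker than expert review; counted 0; proves no summit and closes no registered stub — it PINS both residual stubs to named leaves in the kernel.]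

## What this file does (assembly of LANDED theorems; no definition, no new axiom)

Two of the five piece-families are now tree theorems where they are needed: OX in EVERY dimension (`WildFourCensus.oldExit_any`,
`…NCDirectrixCutWildFourOfLeaves` — res-L1-w43-strat-1's §0, filed by this hand) and CRV₃ (`apexLineCurveExit_three`, p547635); the door RD₂ is
`spaceNCRankDrop` (p578911).  Hence:

* `rd_all_of_pieces` — RD_m for every `m ≥ 2` in characteristic `p` over an algebraically closed field from the four families
  CRV_{m+1} (`m ≥ 3`) · PL_{m+1} · FT_{m+1} · W_{m+1} (`m ≥ 2`);
* `wildWideApexFiveUpStartsWon_of_pieces` — **W|₅₊ VERBATIM** from the same four families (via `NCTransport.wildWideApexFiveUpStartsWon_of_ncRankDrop`);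
* `tameWideApexFiveUpStartsWon_of_pieces` — **T|₅₊ VERBATIM** from the same four families (via `NCTransport.tameWideApexFiveUpStartsWon_of_ncRankDropBelow`,
  the tame maximal-contact dimension drop: T|₅₊ at `n` costs RD_{n+3}, one dimension fewer).
Honest label: above dimension 4 none of CRV/PL/FT/W is in print (CJS/KM-class only in ambient dimension ≤ 4; W is the open core in every dimension);
the hypothesis lists are the remaining-lemma census of the two residual registered stubs, nothing more.
-/

set_option linter.dupNamespace false -- mandated namespace of this single-conjunct summit

noncomputable section

namespace Summit.ResolutionOfSingularities.ResolutionOfSingularities.Theorems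

namespace TameFourTupleDrop

namespace FiveUpCensus

open MvPowerSeries Literature.AlgebraicGeometry.Resolution NCTransport

/-- **RD in every dimension from the four open piece-families** (door RD₂ = `spaceNCRankDrop`, OX = `WildFourCensus.oldExit_any` in every dimension,
CRV₃ = `apexLineCurveExit_three` discharged). [OURS · W|₅₊/T|₅₊ kernel census] -/
theorem rd_all_of_pieces
    (hcrv : ∀ (p : ℕ), p.Prime → ∀ (k : Type) [Field k] [CharP k p] [IsAlgClosed k], ∀ m : ℕ, 3 ≤ m → ApexLineCurveExit k (m + 1))
    (hpl : ∀ (p : ℕ), p.Prime → ∀ (k : Type) [Field k] [CharP k p] [IsAlgClosed k], ∀ m : ℕ, 2 ≤ m → ApexPlaneExit k (m + 1))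
    (hFT : ∀ (p : ℕ), p.Prime → ∀ (k : Type) [Field k] [CharP k p] [IsAlgClosed k], ∀ m : ℕ, 2 ≤ m → FreeTame p k (m + 1))
    (hW : ∀ (p : ℕ), p.Prime → ∀ (k : Type) [Field k] [CharP k p] [IsAlgClosed k], ∀ m : ℕ, 2 ≤ m → CoreUnaryWild p k (m + 1)) :
    ∀ (p : ℕ), p.Prime → ∀ (k : Type) [Field k] [CharP k p] [IsAlgClosed k], ∀ m : ℕ, 2 ≤ m → RD k m := by
  intro p hp k _ _ _
  haveI : Infinite k := IsAlgClosed.instInfinite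
  refine rd_all_of_histApexCut (p := p) (spaceNCRankDrop p hp k) fun m hm => ⟨WildFourCensus.oldExit_any, ?_, hpl p hp k m hm, hFT p hp k m hm, hW p hp k m hm⟩
  rcases Nat.eq_or_lt_of_le hm with h2 | h3
  · subst h2
    exact apexLineCurveExit_three p hp k
  · exact hcrv p hp k m (by omega)

/-- **W|₅₊ = registered `stub_wildWideApexFiveUpStartsWon` VERBATIM from the four open piece-families.** [OURS · W|₅₊ kernel census] -/
theorem wildWideApexFiveUpStartsWon_of_pieces
    (hcrv : ∀ (p : ℕ), p.Prime → ∀ (k : Type) [Field k] [CharP k p] [IsAlgClosed k], ∀ m : ℕ, 3 ≤ m → ApexLineCurveExit k (m + 1))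
    (hpl : ∀ (p : ℕ), p.Prime → ∀ (k : Type) [Field k] [CharP k p] [IsAlgClosed k], ∀ m : ℕ, 2 ≤ m → ApexPlaneExit k (m + 1))
    (hFT : ∀ (p : ℕ), p.Prime → ∀ (k : Type) [Field k] [CharP k p] [IsAlgClosed k], ∀ m : ℕ, 2 ≤ m → FreeTame p k (m + 1))
    (hW : ∀ (p : ℕ), p.Prime → ∀ (k : Type) [Field k] [CharP k p] [IsAlgClosed k], ∀ m : ℕ, 2 ≤ m → CoreUnaryWild p k (m + 1)) :
    ∀ (p : ℕ), p.Prime → ∀ (k : Type) [Field k] [CharP k p] [IsAlgClosed k]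
      (n : ℕ), (∀ m : ℕ, m < n + 5 → ∀ g : MvPowerSeries (Fin m) k,
        CobordantGame.IsSingular k g → CobordantGame.Won k m g) →
      ∀ (f : MvPowerSeries (Fin (n + 5)) k), CobordantGame.IsSingular k f →
      (∀ g : MvPowerSeries (Fin (n + 5)) k, CobordantGame.IsSingular k g → g.order < f.order →
        CobordantGame.Won k (n + 5) g) →
      ∀ (d : ℕ), f.order = d → p ∣ d →
      (∃ ℓ : Fin (n + 5) → k, ∀ i j : Fin (n + 5),
        MvPowerSeries.coeff (Finsupp.single i 1 + Finsupp.single j 1) f =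
          MvPowerSeries.coeff (Finsupp.single i 1 + Finsupp.single j 1)
            ((∑ l, MvPowerSeries.C (ℓ l) * MvPowerSeries.X l) ^ 2)) →
      (2 < d → ∃ c₁ c₂ : Fin (n + 5) → k, (∀ α β : k, α • c₁ + β • c₂ = 0 → α = 0 ∧ β = 0) ∧
        (∀ v : Fin (n + 5) → k, CobordantChart.initEval (fun _ : Fin (n + 5) => 1) (v + c₁) d f =
          CobordantChart.initEval (fun _ : Fin (n + 5) => 1) v d f) ∧
        (∀ v : Fin (n + 5) → k, CobordantChart.initEval (fun _ : Fin (n + 5) => 1) (v + c₂) d f =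
          CobordantChart.initEval (fun _ : Fin (n + 5) => 1) v d f)) →
      CobordantGame.Won k (n + 5) f :=
  wildWideApexFiveUpStartsWon_of_ncRankDrop fun p hp k _ _ _ n => rd_all_of_pieces hcrv hpl hFT hW p hp k (n + 4) (by omega)

/-- **T|₅₊ = registered `stub_tameWideApexFiveUpStartsWon` VERBATIM from the four open piece-families** (one dimension fewer: RD_{n+3}).
[OURS · T|₅₊ kernel census] -/
theorem tameWideApexFiveUpStartsWon_of_pieces
    (hcrv : ∀ (p : ℕ), p.Prime → ∀ (k : Type) [Field k] [CharP k p] [IsAlgClosed k], ∀ m : ℕ, 3 ≤ m → ApexLineCurveExit k (m + 1))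
    (hpl : ∀ (p : ℕ), p.Prime → ∀ (k : Type) [Field k] [CharP k p] [IsAlgClosed k], ∀ m : ℕ, 2 ≤ m → ApexPlaneExit k (m + 1))
    (hFT : ∀ (p : ℕ), p.Prime → ∀ (k : Type) [Field k] [CharP k p] [IsAlgClosed k], ∀ m : ℕ, 2 ≤ m → FreeTame p k (m + 1))
    (hW : ∀ (p : ℕ), p.Prime → ∀ (k : Type) [Field k] [CharP k p] [IsAlgClosed k], ∀ m : ℕ, 2 ≤ m → CoreUnaryWild p k (m + 1)) :
    ∀ (p : ℕ), p.Prime → ∀ (k : Type) [Field k] [CharP k p] [IsAlgClosed k]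
    (n : ℕ), (∀ m : ℕ, m < n + 5 → ∀ g : MvPowerSeries (Fin m) k,
      CobordantGame.IsSingular k g → CobordantGame.Won k m g) →
    ∀ (f : MvPowerSeries (Fin (n + 5)) k), CobordantGame.IsSingular k f →
    (∀ g : MvPowerSeries (Fin (n + 5)) k, CobordantGame.IsSingular k g → g.order < f.order →
      CobordantGame.Won k (n + 5) g) →
    ∀ (d : ℕ), f.order = d → ¬ p ∣ d →
    (∃ ℓ : Fin (n + 5) → k, ∀ i j : Fin (n + 5),
      MvPowerSeries.coeff (Finsupp.single i 1 + Finsupp.single j 1) f =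
        MvPowerSeries.coeff (Finsupp.single i 1 + Finsupp.single j 1)
          ((∑ l, MvPowerSeries.C (ℓ l) * MvPowerSeries.X l) ^ 2)) →
    (2 < d → ∃ c₁ c₂ : Fin (n + 5) → k, (∀ α β : k, α • c₁ + β • c₂ = 0 → α = 0 ∧ β = 0) ∧
      (∀ v : Fin (n + 5) → k, CobordantChart.initEval (fun _ : Fin (n + 5) => 1) (v + c₁) d f =
        CobordantChart.initEval (fun _ : Fin (n + 5) => 1) v d f) ∧
      (∀ v : Fin (n + 5) → k, CobordantChart.initEval (fun _ : Fin (n + 5) => 1) (v + c₂) d f =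
        CobordantChart.initEval (fun _ : Fin (n + 5) => 1) v d f)) →
    CobordantGame.Won k (n + 5) f :=
  tameWideApexFiveUpStartsWon_of_ncRankDropBelow fun p hp k _ _ _ n => rd_all_of_pieces hcrv hpl hFT hW p hp k (n + 3) (by omega)

end FiveUpCensus

end TameFourTupleDrop

end Summit.ResolutionOfSingularities.ResolutionOfSingularities.Theorems

end
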